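import Literature.Algebra.Module.AdjustedCotorsionModulesViaExt
import Literature.Algebra.Module.ExtCardinalityBound
import Mathlib.SetTheory.Cardinal.Continuum
import HarnessLib

/-!
# An adjusted cotorsion module is no larger than `|T(G)|^|K/R|` (`≤ |T(G)|^ℵ₀` over a countable ring)
# (Fuchs, *Infinite Abelian Groups* I, §55 Exercise 5)

Topic `Algebra/Module`; namespace `Literature.Algebra.Module.Extensions` (continuing
`AdjustedCotorsionModulesViaExt.lean` (THEOREM 55.6: an adjusted cotorsion `G` is `≅ Ext(K/R, T(G))`) and
`ExtCardinalityBound.lean` (§58 Exercise 6: `|Ext(C, A)| ≤ |A|^|C|`)). Lane `lit-hodgefound` (Track 2 foundations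
library), prover seat p22 generation 55, row g55-#7. THEOREMS ONLY: no definition, no named fact, no instance, net
debt 0.

VOCABULARY (as in the two files above). `R` is a principal ideal domain with field of fractions `K`, modules live in
the universe of `R`; `G` is *reduced* (`hred`: every divisible submodule is `⊥`), *cotorsion* (`hG`: every
embedding of `G` with torsion-free cokernel has a retraction) and *adjusted* (`hadj`: no non-zero torsion-free
direct summand); `T(G) = Submodule.torsion R G`.

SOURCE, verbatim ([Fuchs1970] §55 Exercises, PDF p. 233): "5. If `G` is adjusted cotorsion with torsion part `T`,
then `|G| ≤ |T|^ℵ₀`." (For `R = ℤ`; the proof intended: `G ≅ Ext(Q/Z, T)` by Theorem 55.6 and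
`|Ext(Q/Z, T)| ≤ |T|^ℵ₀`, §58 Exercise 6.)

## What is proved

* `mk_le_mk_torsion_pow_of_adjusted`: `#G ≤ #T(G) ^ #(K/R)` over any principal ideal domain;
* `mk_le_mk_torsion_pow_aleph0_of_adjusted`: **`#G ≤ #T(G) ^ ℵ₀`** over a countable principal ideal domain
  (Fuchs's statement; `R = ℤ`), together with the trivial `#T(G) ≤ #G`;
* `mk_le_continuum_of_adjusted`: an adjusted cotorsion module with countable torsion part over a countable
  principal ideal domain has cardinality at most `𝔠 = 2^ℵ₀`.

## References

* L. Fuchs, *Infinite Abelian Groups*, Vol. I, Academic Press, 1970, §55 Exercise 5 (PDF p. 233), Theorem 55.6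
  (PDF p. 232), §58 Exercise 6 (PDF p. 243). [Fuchs1970]
* D. K. Harrison, Infinite abelian groups and homological methods, *Ann. of Math.* (2) 69 (1959), 366–391.
  [Harrison1959]
-/

namespace Literature.Algebra.Module.Extensions

universe u

open CategoryTheory CategoryTheory.Abelian Submodule Cardinal
open scoped Pointwise

variable {R : Type u} [CommRing R] [IsDomain R] [IsPrincipalIdealRing R] (G : ModuleCat.{u} R)
  (hred : ∀ D : Submodule R G, (∀ r : R, r ≠ 0 → ∀ x ∈ D, ∃ y ∈ D, r • y = x) → D = ⊥)
  (hG : ∀ (N : Type u) [AddCommGroup N] [Module R N] (j : G →ₗ[R] N), Function.Injective j →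
    Module.IsTorsionFree R (N ⧸ LinearMap.range j) → ∃ ρ : N →ₗ[R] G, ρ ∘ₗ j = LinearMap.id)
  (hadj : ∀ X Y : Submodule R G, IsCompl X Y → Module.IsTorsionFree R X → X = ⊥)
include hred hG hadj

/-- **`|G| ≤ |T(G)|^|K/R|` for an adjusted cotorsion module `G`** over a principal ideal domain: `G ≅ Ext(K/R, T(G))`
(THEOREM 55.6) and `|Ext(C, A)| ≤ |A|^|C|` (§58 Exercise 6). [cite: Fuchs1970, §55 Exercise 5 (PDF p. 233);
Theorem 55.6 (PDF p. 232); §58 Exercise 6 (PDF p. 243)] -/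
theorem mk_le_mk_torsion_pow_of_adjusted :
    #G ≤ #(torsion R G) ^ #(FractionRing R ⧸ (1 : Submodule R (FractionRing R))) := by
  obtain ⟨e, -⟩ := exists_linearEquiv_ext_torsion_of_adjusted G hred hG hadj
  rw [Cardinal.mk_congr e.toEquiv]
  exact mk_ext_fractionRingQuotient_le_pow (ModuleCat.of R (torsion R G))

/-- **§55 EXERCISE 5: `|T(G)| ≤ |G| ≤ |T(G)|^ℵ₀` for an adjusted cotorsion module `G` over a countable principal
ideal domain** (`R = ℤ`: "If `G` is adjusted cotorsion with torsion part `T`, then `|G| ≤ |T|^ℵ₀`").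
[cite: Fuchs1970, §55 Exercise 5 (PDF p. 233); Theorem 55.6 (PDF p. 232); §58 Exercise 6 (PDF p. 243)] -/
theorem mk_le_mk_torsion_pow_aleph0_of_adjusted [Countable R] :
    #(torsion R G) ≤ #G ∧ #G ≤ #(torsion R G) ^ ℵ₀ := by
  refine ⟨Cardinal.mk_le_of_injective (torsion R G).subtype_injective, ?_⟩
  obtain ⟨e, -⟩ := exists_linearEquiv_ext_torsion_of_adjusted G hred hG hadj
  rw [Cardinal.mk_congr e.toEquiv]
  exact mk_ext_fractionRingQuotient_le_pow_aleph0_of_countable (ModuleCat.of R (torsion R G))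

/-- **An adjusted cotorsion module with countable torsion part, over a countable principal ideal domain, has
cardinality at most `2^ℵ₀`** (`|T|^ℵ₀ ≤ ℵ₀^ℵ₀ = 2^ℵ₀`). [cite: Fuchs1970, §55 Exercise 5 (PDF p. 233)] -/
theorem mk_le_continuum_of_adjusted [Countable R] [Countable (torsion R G)] : #G ≤ 𝔠 := by
  refine (mk_le_mk_torsion_pow_aleph0_of_adjusted G hred hG hadj).2.trans ?_
  rw [← Cardinal.aleph0_power_aleph0]
  exact Cardinal.power_le_power_right Cardinal.mk_le_aleph0

end Literature.Algebra.Module.Extensions
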